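import Literature.ComputerArithmetic.Shewchuk1997.FastExpansionSum
import Mathlib.Data.List.Triplewise

/-!
# Weakly nonoverlapping expansions: the invariant of FAST-EXPANSION-SUM
# (a repaired form of Theorem 13 of Shewchuk 1997, proved)

HONEST FRAMING (ENGINES group, unit `eng-quad-4`, kernels lane of the `certquad` engine — shared
numerical engines serving client cells; rigour lives in the verifiers; every published number
belongs to a client cell's ledger, not to the engines group): this is NEW WORK of the lane's Lean
line, not a published result, hence it lives under `Summits/Ventures/` and carries no citation tag of
its own.  No statement of this file is cited anywhere as a literature fact.

CONTEXT.  `Literature/ComputerArithmetic/Shewchuk1997/FastExpansionSum.lean` types §2.4 of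
J. R. Shewchuk, *Adaptive precision floating-point arithmetic and fast robust geometric predicates*,
Discrete Comput. Geom. 18 (1997) 305–363: FAST-EXPANSION-SUM (`fastExpansionSum`), the strongly
nonoverlapping property (`IsStrongExpansion`), Lemmas 14–16, and the TRUE part of Theorem 13
(pp. 319–322): for strongly nonoverlapping inputs the output is a nonoverlapping expansion with the
exact sum, for ANY round-to-nearest rounding (`fastExpansionSum_nonoverlapping`).  The companion file
`FastExpansionSumCounterexample.lean` of this directory proves that the printed conclusion "`h` is
strongly nonoverlapping" is FALSE (`e = ⟨2^p + 2⟩`, `f = ⟨−(2^(p−1) − 1), −2^p⟩`, round-half-even,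
every `p ≥ 4`, output `⟨1, 0, −(2^(p−1) − 2)⟩`), so Theorem 13 cannot be re-applied to its own
outputs as stated, and it left OPEN whether some weaker property IS preserved.  This file answers
that question: yes — the following class, read off the searches reported there, is closed under
FAST-EXPANSION-SUM with round-half-even for every `p ≥ 4`, and the algorithm is correct on it under
any round-to-nearest rounding.

THE CLASS (§1; components listed smallest first, zeros allowed anywhere; `Below c x y`: `y ∈ 2^s ℤ`
and `c|x| < 2^s` for some `s` — `c = 1` nonoverlapping, `c = 2` nonadjacent, as in the Literature
files).  `WeakBelow x y := Below 2 x y ∨ (Below 1 x y ∧ |x| = 2^a for some a)`: an ADJACENT pair is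
allowed provided its LOWER member is a one-bit number (the upper member is unconstrained — this is
exactly what the counterexample output `⟨1, 0, −(2^(p−1) − 2)⟩` needs and what "strongly
nonoverlapping" forbids).  `NoDouble x y z := Below 2 x y ∨ Below 2 y z`: of two consecutive gaps at
least one is a nonadjacent gap, i.e. no component is adjacent to two others.  A WEAKLY NONOVERLAPPING
EXPANSION (`IsWeakExpansion l := l.Pairwise WeakBelow ∧ l.Triplewise NoDouble`) is thus sorted by
magnitude except for zeros and nonoverlapping (`IsWeakExpansion.isExpansion`), and
nonadjacent ⊂ strongly nonoverlapping ⊂ weakly nonoverlapping ⊂ nonoverlapping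
(`IsStrongExpansion.isWeakExpansion`; `⟨1, 0, −6⟩ ∈ W ∖ SNS`, `⟨1, 2, 4⟩ ∉ W`:
`isWeakExpansion_example₁/₂`).

THEOREM 1 (`fastExpansionSum_nonoverlapping_of_isWeakExpansion`; any round-to-nearest rounding
`IsRoundNearest p emin fl`, any tie rule, gradual underflow included, `p ≥ 4`).  If `e` and `f` are
weakly nonoverlapping expansions of `p`-bit floats then `h = FAST-EXPANSION-SUM(e, f)` is a
nonoverlapping expansion (increasing except for zeros) of `m + n` floats with `Σ h = Σ e + Σ f`.
THEOREM 2 (`fastExpansionSum_isWeakExpansion`; `p ≥ 4`; any round-to-nearest rounding whose roundoff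
is 2-below its result, `RoundoffBelow 2 fl` — Corollary 9 of the paper; IEEE round-half-even
qualifies, `roundoffBelow_two_roundTiesEven`, whence `fastExpansionSum_isWeakExpansion_roundTiesEven`
and the combined `fastExpansionSum_spec_roundTiesEven`).  If `e` and `f` are weakly nonoverlapping
then so is `FAST-EXPANSION-SUM(e, f)`.  Consequently FAST-EXPANSION-SUM may be iterated on its own
outputs, which is how §3–§4 of the paper use Theorem 13; replacing "strongly nonoverlapping" by
"weakly nonoverlapping" in BOTH the hypothesis and the conclusion of Theorem 13 gives a true statement
(round-half-even, `p ≥ 4`) containing the true part of the printed one.  The other producers of the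
paper return NONADJACENT expansions under round-half-even — GROW-EXPANSION and EXPANSION-SUM
(`growExpansion_nonadjacent`, `expansionSum_nonadjacent`), SCALE-EXPANSION on nonadjacent input
(`scaleExpansion_nonadjacent`), COMPRESS (`compress_nonadjacent_roundTiesEven`) — and nonadjacent
expansions are weakly nonoverlapping.  NOT decided here (nothing is claimed): whether SCALE-EXPANSION
maps weakly nonoverlapping inputs to weakly nonoverlapping outputs (its printed strongly-nonoverlapping
version, Corollary 22, is refuted in `ScaleExpansionCounterexample.lean`; in an integer-model search —
`p = 4`: 288 052 runs, `p = 5`: 651 796 runs over weakly nonoverlapping `e` and odd `b` — no output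
left the class; computational evidence only, not formalised).

WHY THE TWO EXTRA HYPOTHESES OF THEOREM 2 (computational evidence from the same integer model,
re-derived by hand, NOT formalised; `p = 4`).  (a) `NoDouble` is load-bearing already for Theorem 1:
the pairwise-`WeakBelow` inputs `e = ⟨−4, −8, −16, −32, −64, 1920⟩`,
`f = ⟨−4, −8, −16, −32, −64, −128, −1792⟩` (chains of adjacent one-bit components) give, under
round-half-even, `h = ⟨0, 0, 0, 0, 0, 0, 0, 8, 0, 0, −128, 0, −128⟩`, which is NOT EVEN NONOVERLAPPING
(two components `−128`; the sum `−248` is still exact).  (b) The tie rule matters for Theorem 2 (not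
for Theorem 1): with ties-away-from-zero `⟨−4, 24⟩ + ⟨−1, −26, 64⟩ = ⟨0, −1, 0, −2, 60⟩`, with
ties-toward-zero `⟨2, −16, 96⟩ + ⟨3, −16, 64⟩ = ⟨0, 0, −1, 2, 4, 128⟩`, with ties-to-odd
`⟨−1, −18⟩ + ⟨−24⟩ = ⟨−1, 2, −44⟩` — weakly nonoverlapping inputs, nonoverlapping outputs (as
Theorem 1 demands) containing a component adjacent to two others (`−1, −2, 60`; `−1, 2, 4`;
`−1, 2, −44`).  (c) `p ≥ 4` is the paper's hypothesis and is used in the case analyses of §6 and §8;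
`p ≤ 3` is not investigated.  NEAREST FORMAL PRIOR ART KNOWN TO US: the Coq/Flocq verification by
Boldo, Joldes, Muller and Popescu (ITP 2017, LNCS 10499, doi:10.1007/978-3-319-66107-0_7) of an
expansion RENORMALIZATION algorithm for their "ulp-nonoverlapping" condition — a different one-bit
relaxation (of Priest's digit-wise nonoverlapping: consecutive components may overlap by one bit when
the smaller is a power of two) — which likewise reports intermediate zeros as the case pen-and-paper
proofs overlook; it does not treat FAST-EXPANSION-SUM or the strongly nonoverlapping property.

PROOF (new; the printed proof's Lemma 15 / footnote 5 route does not survive weak inputs, whose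
processed tails are only `< ¾·2^v` below an odd multiple of `2^v` instead of `< ½·2^v`).  Write the
loop state as processed prefixes `e₁, f₁`, unprocessed suffixes, accumulator `Q`, outputs so far `hs`.
§2 TAIL BOUND: in a weakly nonoverlapping expansion the components below an odd multiple of `2^v` sum
to `< ¾·2^v` (`abs_sum_lt_of_isWeakExpansion_append'`).  §3 TOP COMPONENT: if such an expansion sums
to `> (2^p − 1)·2^T` while its top component is `≤ (2^p − 1)·2^T` in magnitude, the top component is
`(2^p − 1)·2^T` or `(2^p − 2)·2^T` exactly (`abs_top_of_isWeakExpansion`).  §4 THE STRENGTHENED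
INVARIANT `FesInvW` = the Literature invariant `FesInv` (exact bookkeeping `Q + Σ hs = Σ e₁ + Σ f₁`,
ordering, a grid `2^g` containing `Q` and all unprocessed components with `|Σ hs| < 2^g`) + a HISTORY
BOUND: for every `a`, if all partial sums `Σ e' + Σ f'` over prefixes `e' ≤ e₁`, `f' ≤ f₁` are
`< 2^a − 2^(a−p)` then every output so far is `≤ 2^(a−1−p)` (propagated by the plain error bound of
rounding to nearest).  §5 CORE DICHOTOMY (`FesInvW.core`): if after processing `z` the processed sum
exceeds `(2^p − ¼)·2^j` while some unprocessed `x₀` is an odd multiple of `2^j`, then `x₀` is in the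
OTHER expansion, `|Σ f₁| < ¾·2^j`, and either (A) `|z| = (2^p − 1)·2^j`, `|Σ e₁| < ¾·2^j`,
`|Σ hs| < 2^(j+1−p)` or (B) `|z| = (2^p − 2)·2^j`, `|Σ e₁| < 1½·2^j`, `|Σ hs| < 2^(j+2−p)` (§2, §3 and
the history bound).  §6 STEP (`FesInvW.step`): after `(Q', h) := TWO-SUM(Q, z)` with `h ≠ 0`,
`T = ⌊log₂|h|⌋`, every unprocessed component is a multiple of `2^(T+1)` — else §5 with `j = T` bounds
`|Q + z| < (2^p + 1)·2^T`, contradicting Corollary 8(a) (`FesInvW.prelude`); the grid `2^(T+1)` then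
carries `Q'` and dominates `|Σ hs'|`.  §7 THEOREM 1 by induction over the loop, every later output
lying on the grid `2^(T+1) > |h|` (grid invariant of GROW-EXPANSION, `onGrid_of_mem_growExpansion`).
§8 LOWER MEMBER (`FesInvW.lower_member`): moreover EITHER `Q'` and all unprocessed components are
multiples of `2^(T+2)` OR `|h| = 2^T` — if `|h| > 2^T` then `ulp(Q + z) ≥ 2^(T+2)`, an unprocessed odd
multiple of `2^(T+1)` invokes §5 with `j = T + 1`, case (B) is absurd and case (A) pins `|Q|` to
`2^(T+1) + 2^T + 2^(T+1−p)`, not a `p`-bit float.  §9 NO TWO (`FesInvW.claimN`, `p ≥ 3`): the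
unprocessed components never contain both an odd multiple of `2^(T+1)` and one of `2^(T+2)` (their
tails would bound the processed sum by `5½·2^T < 2^(T+p)`).  §10 (`FesInvW.advance₂`): under
`RoundoffBelow 2` the new accumulator is a multiple of `2^(T+2)` (TWO-SUM's roundoff is 2-below its
result).  §11 THEOREM 2 by induction carrying, besides Theorem 1's data, pairwise `WeakBelow`,
triplewise `NoDouble` and the ADJACENCY WITNESS `AdjW`: an output `a` adjacent to a later output has
an odd multiple of `2^(⌊log₂|a|⌋+1)` among the components unprocessed at its emission; a double
adjacency `h — w₁ — w₂` forces `|w₁| = 2^(T+1)` and two witnesses excluded by §9.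

FILES (the development is split in six, each importing the previous one; all definitions are in
this one): `WeakExpansion.lean` (§1 the class, the records `FesInvW` / `AdjFacts` / `AdjW`, this
overview), `WeakExpansionInvariant.lean` (§2–§4), `WeakExpansionStep.lean` (§5–§6),
`WeakExpansionNonoverlapping.lean` (§7, Theorem 1), `WeakExpansionAdjacency.lean` (§8–§9),
`WeakExpansionClosure.lean` (§10–§11, Theorem 2).

PROVED IN THESE FILES (0 sorry; new definitions `WeakBelow`, `NoDouble`, `IsWeakExpansion`, the invariant
`FesInvW`, the bookkeeping records `AdjFacts`, `AdjW`): the §1 API (`IsWeakExpansion.isExpansion`,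
`.sublist`, `.pairwise_abs_le`, `IsStrongExpansion.isWeakExpansion`, `isWeakExpansion_nil/cons`, …),
`abs_sum_lt_of_isWeakExpansion_append'`, `abs_top_of_isWeakExpansion`, `FesInvW.init/swap/prelude/
core/step/advance/isExpansion_growExpansion/lower_member/claimN/adjFacts/advance₂/
isWeakExpansion_growExpansion`, `onGrid_of_isFloat_of_two_zpow_le`,
`fastExpansionSum_nonoverlapping_of_isWeakExpansion`,
`fastExpansionSum_pairwise_nonoverlapping_of_isWeakExpansion`, `fastExpansionSum_isWeakExpansion`,
`fastExpansionSum_isWeakExpansion_roundTiesEven`, `fastExpansionSum_spec_roundTiesEven`.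
-/

namespace Summit.Ventures.CertifiedArithmetic.Expansions

open Literature.ComputerArithmetic.JeannerodRump2018
open Literature.ComputerArithmetic.BoldoJeannerodMelquiondMuller2023 hiding twoSum twoSum_fst isFloat_twoSum
open Literature.ComputerArithmetic.Shewchuk1997

variable {p : ℕ} {emin : ℤ} {fl : ℚ → ℚ}

/-! ### §1  The class W of weakly nonoverlapping expansions -/

/-- WEAKLY BELOW, the pair condition (oriented, `x` the less significant component): `x` lies
2-below `y` (nonadjacent), OR `x` lies 1-below `y` (nonoverlapping) and `x` is a one-bit number
`|x| = 2^a` — the upper member of an adjacent pair is NOT required to be a power of two. -/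
def WeakBelow (x y : ℚ) : Prop :=
  Below 2 x y ∨ (Below 1 x y ∧ ∃ a : ℤ, |x| = (2 : ℚ) ^ a)

/-- The triple condition "no component is adjacent to two others", oriented: of two consecutive
gaps `x | y | z` (components in increasing order) at least one is a nonadjacent gap. -/
def NoDouble (x y z : ℚ) : Prop :=
  Below 2 x y ∨ Below 2 y z

/-- **WEAKLY NONOVERLAPPING EXPANSION** (components smallest first, any of them may be zero): every
earlier component lies weakly below every later one, and no component is adjacent to two others. -/
def IsWeakExpansion (l : List ℚ) : Prop :=
  l.Pairwise WeakBelow ∧ l.Triplewise NoDouble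

/-- `Triplewise` passes to sublists. -/
theorem triplewise_sublist {α : Type*} {R : α → α → α → Prop} :
    ∀ {l l' : List α}, l'.Sublist l → l.Triplewise R → l'.Triplewise R
  | _, _, List.Sublist.slnil, h => h
  | _, _, List.Sublist.cons _ hsub, h => triplewise_sublist hsub (List.triplewise_cons.mp h).2
  | _, _, List.Sublist.cons_cons _ hsub, h => by
    obtain ⟨hpw, htw⟩ := List.triplewise_cons.mp h
    exact List.triplewise_cons.mpr ⟨hpw.sublist hsub, triplewise_sublist hsub htw⟩

/-- Pairwise nonadjacent lists satisfy the triple condition. -/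
theorem triplewise_noDouble_of_pairwise {l : List ℚ} (h : l.Pairwise (Below 2)) :
    l.Triplewise NoDouble := by
  induction l with
  | nil => exact List.Triplewise.nil
  | cons a l ih =>
    rw [List.pairwise_cons] at h
    exact List.triplewise_cons.mpr ⟨h.2.imp fun hbc => Or.inr hbc, ih h.2⟩

/-- A weakly-below pair is nonoverlapping (1-below). -/
theorem WeakBelow.below_one {x y : ℚ} (h : WeakBelow x y) : Below 1 x y := by
  rcases h with h | ⟨h, -⟩
  · exact h.anti (by norm_num)
  · exact h

/-- The lower member of a weakly-below pair is smaller in magnitude than a nonzero upper member. -/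
theorem WeakBelow.abs_lt {x y : ℚ} (h : WeakBelow x y) (hy : y ≠ 0) : |x| < |y| :=
  h.below_one.abs_lt le_rfl hy

/-- A strongly-below pair is weakly below. -/
theorem weakBelow_of_strongBelow {x y : ℚ} (h : StrongBelow x y) : WeakBelow x y := by
  rcases h with h | ⟨a, hx, hy⟩
  · exact Or.inl h
  · exact Or.inr ⟨StrongBelow.below_one (Or.inr ⟨a, hx, hy⟩), a, hx⟩

/-- Anything is weakly below zero. -/
theorem weakBelow_zero_right (x : ℚ) : WeakBelow x 0 := Or.inl (below_zero_right 2 x)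

/-- Zero is weakly below any float. -/
theorem weakBelow_zero_left {y : ℚ} (hy : IsFloat p emin y) : WeakBelow 0 y :=
  Or.inl (below_zero_left hy 2)

/-- A weakly nonoverlapping expansion is a nonoverlapping (increasing except zeros) expansion. -/
theorem IsWeakExpansion.isExpansion {l : List ℚ} (h : IsWeakExpansion l) : IsExpansion 1 l :=
  h.1.imp fun hab => hab.below_one

/-- Sublists of weakly nonoverlapping expansions are weakly nonoverlapping. -/
theorem IsWeakExpansion.sublist {l l' : List ℚ} (h : IsWeakExpansion l) (hl : l'.Sublist l) :
    IsWeakExpansion l' :=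
  ⟨h.1.sublist hl, triplewise_sublist hl h.2⟩

/-- A weakly nonoverlapping expansion is sorted by magnitude except for zeros. -/
theorem IsWeakExpansion.pairwise_abs_le {l : List ℚ} (h : IsWeakExpansion l) :
    l.Pairwise fun a b => b ≠ 0 → |a| ≤ |b| :=
  h.1.imp fun hab hb => (hab.abs_lt hb).le

/-- The empty expansion is weakly nonoverlapping. -/
theorem isWeakExpansion_nil : IsWeakExpansion [] := ⟨List.Pairwise.nil, List.Triplewise.nil⟩

/-- Unfolding `IsWeakExpansion` at a head component. -/
theorem isWeakExpansion_cons {x : ℚ} {l : List ℚ} :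
    IsWeakExpansion (x :: l) ↔
      (∀ y ∈ l, WeakBelow x y) ∧ l.Pairwise (NoDouble x) ∧ IsWeakExpansion l := by
  simp only [IsWeakExpansion, List.pairwise_cons, List.triplewise_cons]
  tauto

/-- Nonadjacent expansions are weakly nonoverlapping. -/
theorem IsExpansion.isWeakExpansion_of_two {l : List ℚ} (h : IsExpansion 2 l) :
    IsWeakExpansion l :=
  ⟨h.imp fun hab => Or.inl hab, triplewise_noDouble_of_pairwise h⟩

/-- Strongly nonoverlapping expansions are weakly nonoverlapping. -/
theorem IsStrongExpansion.isWeakExpansion {l : List ℚ} (h : IsStrongExpansion l) :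
    IsWeakExpansion l := by
  refine ⟨h.1.imp weakBelow_of_strongBelow, ?_⟩
  rw [List.triplewise_iff_getElem]
  intro i j k hij hjk hk
  have hpw := List.pairwise_iff_getElem.mp h.1
  have hxy : StrongBelow l[i] l[j] := hpw i j (by omega) (by omega) hij
  have hyz : StrongBelow l[j] l[k] := hpw j k (by omega) hk hjk
  by_contra hnd
  rw [NoDouble, not_or] at hnd
  rcases hxy with hxy | ⟨a, hx, hy⟩
  · exact hnd.1 hxy
  rcases hyz with hyz | ⟨b, hy', hz⟩
  · exact hnd.2 hyz
  have hy0 : l[j] ≠ 0 := by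
    intro h0; rw [h0, abs_zero] at hy; exact (zpow_pos (by norm_num : (0:ℚ) < 2) _).ne hy
  refine h.2 l[j] (List.getElem_mem _) hy0 ?_ ?_
  · exact List.mem_map.mpr ⟨l[i], List.getElem_mem _, by
      rw [hx, hy, zpow_add_one₀ (by norm_num : (2:ℚ) ≠ 0)]; ring⟩
  · exact List.mem_map.mpr ⟨l[k], List.getElem_mem _, by
      rw [hz, hy', zpow_add_one₀ (by norm_num : (2:ℚ) ≠ 0)]; ring⟩

/-- Example: `⟨1, 0, −6⟩` (the shape of the FAST-EXPANSION-SUM output refuting the printed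
Theorem 13 for `p = 4`) is weakly but not strongly nonoverlapping. -/
theorem isWeakExpansion_example₁ :
    IsWeakExpansion [1, 0, -6] ∧ ¬ IsStrongExpansion [1, 0, -6] := by
  have h6 : ∀ s : ℤ, OnGrid s (-6 : ℚ) → s ≤ 1 := fun s hs =>
    OnGrid.le_of_odd (M := -3) (v := 1) (by decide) (by norm_num; exact hs)
  have hnb : ¬ Below 2 (1 : ℚ) (-6) := by
    rintro ⟨s, hs, hlt⟩
    have := zpow_le_zpow_right₀ (by norm_num : (1:ℚ) ≤ 2) (h6 s hs)
    norm_num at hlt; linarith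
  refine ⟨⟨?_, ?_⟩, fun h => ?_⟩
  · have h10 : WeakBelow (1 : ℚ) 0 := weakBelow_zero_right 1
    have h16 : WeakBelow (1 : ℚ) (-6) :=
      Or.inr ⟨⟨1, ⟨-3, by norm_num⟩, by norm_num⟩, 0, by norm_num⟩
    have h06 : WeakBelow (0 : ℚ) (-6) :=
      Or.inl ⟨1, ⟨-3, by norm_num⟩, by norm_num⟩
    refine List.Pairwise.cons ?_ (List.Pairwise.cons ?_ (List.pairwise_singleton _ _))
    · intro y hy
      simp only [List.mem_cons, List.not_mem_nil, or_false] at hy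
      rcases hy with rfl | rfl
      · exact h10
      · exact h16
    · intro y hy
      rw [List.mem_singleton.mp hy]; exact h06
  · exact List.triplewise_triple.mpr (Or.inl (below_zero_right 2 1))
  · have h16 : StrongBelow (1 : ℚ) (-6) := by
      exact (List.pairwise_cons.mp h.1).1 (-6) (by simp)
    rcases h16 with h16 | ⟨a, h1, h6'⟩
    · exact hnb h16
    · have ha : a = 0 := by
        have : (2 : ℚ) ^ a = (2 : ℚ) ^ (0 : ℤ) := by rw [← h1]; norm_num
        exact zpow_right_injective₀ (by norm_num) (by norm_num) this
      rw [ha] at h6'; norm_num at h6'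

/-- Example: three consecutive powers of two are pairwise weakly below each other but violate the
triple condition. -/
theorem isWeakExpansion_example₂ : ¬ IsWeakExpansion [1, 2, 4] := by
  intro h
  have ht := List.triplewise_triple.mp h.2
  have h2 : ∀ s : ℤ, OnGrid s (2 : ℚ) → s ≤ 1 := fun s hs =>
    OnGrid.le_of_odd (M := 1) (v := 1) (by decide) (by norm_num; exact hs)
  have h4 : ∀ s : ℤ, OnGrid s (4 : ℚ) → s ≤ 2 := fun s hs =>
    OnGrid.le_of_odd (M := 1) (v := 2) (by decide) (by norm_num; exact hs)
  rcases ht with ⟨s, hs, hlt⟩ | ⟨s, hs, hlt⟩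
  · have := zpow_le_zpow_right₀ (by norm_num : (1:ℚ) ≤ 2) (h2 s hs)
    norm_num at hlt this; linarith
  · have := zpow_le_zpow_right₀ (by norm_num : (1:ℚ) ≤ 2) (h4 s hs)
    norm_num at hlt this; linarith

/-! ### Records used by parts 2–6: the strengthened loop invariant and the adjacency bookkeeping

(Stated here so that the later files introduce no definitions.)  `FesInvW` is `FesInv` — the
relational invariant of the published proof, `FastExpansionSum.lean` — together with ONE extra field
`hist`: for every scale `2^a` below which ALL pair prefix sums `Σe' + Σf'` (`e' <+: e₁`, `f' <+: f₁`)
stay with a margin `2^(a−p)`, every output emitted so far is at most half an ulp at that scale,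
`|h| ≤ 2^(a−1−p)`; this statement about the whole history of the run replaces the second bound of
Lemma 15 for weak inputs (§4–§6).  `AdjFacts` / `AdjW` are what Theorem 2's induction records about a
nonzero output against the later data (§10–§11). -/

/-- The invariant of the main loop for WEAK inputs: `FesInv` plus the history bound. -/
structure FesInvW (p : ℕ) (emin : ℤ) (e f e₁ f₁ e₂ f₂ : List ℚ) (Q : ℚ) (hs : List ℚ) (g : ℤ) :
    Prop where
  inv : FesInv p emin e f e₁ f₁ e₂ f₂ Q hs g
  hist : ∀ a : ℤ, (∀ e' f' : List ℚ, e' <+: e₁ → f' <+: f₁ →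
      |e'.sum + f'.sum| < (2 : ℚ) ^ a - (2 : ℚ) ^ (a - p)) → ∀ h ∈ hs, |h| ≤ (2 : ℚ) ^ (a - 1 - p)

/-- The strengthened invariant is symmetric in the two input expansions. -/
theorem FesInvW.swap {e f e₁ f₁ e₂ f₂ : List ℚ} {Q : ℚ} {hs : List ℚ} {g : ℤ}
    (hI : FesInvW p emin e f e₁ f₁ e₂ f₂ Q hs g) : FesInvW p emin f e f₁ e₁ f₂ e₂ Q hs g where
  inv := hI.inv.swap
  hist := fun a ha => hI.hist a fun e' f' he' hf' => by rw [add_comm]; exact ha f' e' hf' he'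

/-- The strengthened invariant holds initially (nothing processed, `Q = 0`, no outputs,
grid `2^emin`). -/
theorem FesInvW.init {e f : List ℚ} (heF : ∀ x ∈ e, IsFloat p emin x)
    (hfF : ∀ x ∈ f, IsFloat p emin x) : FesInvW p emin e f [] [] e f 0 [] emin where
  inv := FesInv.init heF hfF
  hist := fun _ _ h hh => by simp at hh

/-- The adjacency facts recorded for a nonzero output `h` with `T = ⌊log₂|h|⌋`, against the later
data: the new accumulator `Q'` and the unprocessed components `rs`. -/
structure AdjFacts (rs : List ℚ) (Q' h : ℚ) (T : ℤ) : Prop where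
  gridQ : OnGrid (T + 2) Q'
  dich : (∀ x ∈ rs, OnGrid (T + 2) x) ∨
    (|h| = (2 : ℚ) ^ T ∧ ∃ x ∈ rs, ∃ M : ℤ, Odd M ∧ x = (M : ℚ) * (2 : ℚ) ^ (T + 1))
  noTwo : ∀ x ∈ rs, ∀ y ∈ rs, ∀ Mx My : ℤ, Odd Mx → Odd My →
    x = (Mx : ℚ) * (2 : ℚ) ^ (T + 1) → y = (My : ℚ) * (2 : ℚ) ^ (T + 2) → False

/-- The adjacency witness: if `a` is adjacent to (not 2-below) `b`, some `x ∈ rs` is an odd multiple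
of `2^(⌊log₂|a|⌋+1)`. -/
def AdjW (rs : List ℚ) (a b : ℚ) : Prop :=
  ¬ Below 2 a b → ∃ x ∈ rs, ∃ M : ℤ, Odd M ∧ x = (M : ℚ) * (2 : ℚ) ^ (Int.log 2 |a| + 1)

/-- The adjacency witness is monotone in the list of candidates. -/
theorem AdjW.mono {rs : List ℚ} (z : ℚ) {a b : ℚ} (hab : AdjW rs a b) : AdjW (z :: rs) a b :=
  fun hnb => let ⟨x, hx, M, hM, hxe⟩ := hab hnb; ⟨x, List.mem_cons_of_mem z hx, M, hM, hxe⟩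

end Summit.Ventures.CertifiedArithmetic.Expansions
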